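import Summits.AtomisticToContinuum.FouriersLaw.Theorems.OddSectorIrreversibilityGreenKuboWindowFubini

/-!
# The windowed Kubo corrector is square-integrable (support for stmt-AtomisticToContinuum-10924)

Sequel to `OddSectorIrreversibilityGreenKuboWindowFubini.lean` (route `OddSectorIrreversibility`,
sub-problem `FouriersLaw`; fixed-`N` bookkeeping for `WitnessGlue` / `CorrectorTheory` on the way to
the shared item `BoundedResponse`). For `pinnedChain ω₂ lam β γ` (`ω₂ > 0`, `lam ≥ 0`, `β, γ > 0`),
`N ≥ 1`, `T > 0`, `J = ∑_i j_i`, `P_t = transitionKernel N T T t`, `π = gibbsMeasure N T` and the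
finite-horizon Kubo corrector `u_τ = ∫_{(0,τ]} P_t J dt`:

* `sq_setIntegral_Ioc_le` — Jensen in time on the window, `(∫_{(0,τ]} g)² ≤ τ ∫_{(0,τ]} g²`;
* `pinnedChain_sq_windowedCorrector_le` — `u_τ ∈ L²(π)` with `∫ u_τ² dπ ≤ τ² ∫ J² dπ` (Jensen,
  Tonelli, `L²(π)`-contraction of each `P_t`). In particular the `L²(μ_T)`-convergence conjunct A(4)
  of `CorrectorTheory` is a statement about honest (finite) integrals.

No definitions, no named facts; nothing here closes an item.
-/

noncomputable section

open MeasureTheory ProbabilityTheory Filter Topology Set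
open scoped NNReal ENNReal

namespace Summit.AtomisticToContinuum.FouriersLaw.Theorems

open Literature.MathematicalPhysics.KineticTheory.HeatConduction
open Literature.MathematicalPhysics.KineticTheory Literature.Probability.Process OscillatorChain
open Summit.AtomisticToContinuum.FouriersLaw.Theorems.SubdiffusiveBondHeat

/-- Jensen in time on the window: `(∫_{(0,τ]} g)² ≤ τ ∫_{(0,τ]} g²` for `g, g² ∈ L¹((0,τ])`,
`τ ≥ 0` (expand `0 ≤ ∫ (g - m)²` with `m` the window mean). [folklore] -/
theorem sq_setIntegral_Ioc_le {g : ℝ → ℝ} {τ : ℝ} (hτ : 0 ≤ τ)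
    (hg : IntegrableOn g (Ioc 0 τ)) (hg2 : IntegrableOn (fun t => g t ^ 2) (Ioc 0 τ)) :
    (∫ t in Ioc 0 τ, g t) ^ 2 ≤ τ * ∫ t in Ioc 0 τ, g t ^ 2 := by
  rcases eq_or_lt_of_le hτ with h0 | hpos
  · subst h0
    simp
  have hνu : (volume.restrict (Ioc (0 : ℝ) τ)).real univ = τ := by
    rw [Measure.real, Measure.restrict_apply MeasurableSet.univ, univ_inter, Real.volume_Ioc,
      sub_zero, ENNReal.toReal_ofReal hτ]
  have hexp : ∫ t in Ioc 0 τ, (g t - (∫ s in Ioc 0 τ, g s) / τ) ^ 2 =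
      (∫ t in Ioc 0 τ, g t ^ 2) - (∫ s in Ioc 0 τ, g s) ^ 2 / τ := by
    have e : (fun t => (g t - (∫ s in Ioc 0 τ, g s) / τ) ^ 2) =
        fun t => g t ^ 2 - (2 * ((∫ s in Ioc 0 τ, g s) / τ)) * g t +
          ((∫ s in Ioc 0 τ, g s) / τ) ^ 2 := by
      funext t; ring
    have i1 : IntegrableOn (fun t => g t ^ 2 - 2 * ((∫ s in Ioc 0 τ, g s) / τ) * g t) (Ioc 0 τ) :=
      hg2.sub (hg.const_mul _)
    rw [e, integral_add i1 (integrable_const _), integral_sub hg2 (hg.const_mul _),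
      integral_const_mul, integral_const, hνu, smul_eq_mul]
    field_simp
    ring
  have hnn : 0 ≤ ∫ t in Ioc 0 τ, (g t - (∫ s in Ioc 0 τ, g s) / τ) ^ 2 :=
    integral_nonneg fun t => sq_nonneg _
  rw [hexp] at hnn
  have : (∫ s in Ioc 0 τ, g s) ^ 2 / τ ≤ ∫ t in Ioc 0 τ, g t ^ 2 := by linarith
  rwa [div_le_iff₀ hpos, mul_comm] at this

section WindowSq

variable {ω₂ lam β γ : ℝ} (hω : 0 < ω₂) (hl : 0 ≤ lam) (hβ : 0 < β) (hγ : 0 < γ) {N : ℕ} (hN : 0 <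
      N)
  {T : ℝ} (hT : 0 < T)


include hω hl hβ hγ hN hT

/-- **The windowed corrector is square-integrable**: for `τ ≥ 0`, `u_τ² ∈ L¹(π)` and
`∫ u_τ² dπ ≤ τ² ∫ J² dπ` (Jensen on the window, Tonelli, `L²(π)`-contraction of each `P_t`).
[folklore] -/
theorem pinnedChain_sq_windowedCorrector_le {τ : ℝ} (hτ : 0 ≤ τ) :
    Integrable (fun z => (∫ t in Ioc 0 τ, (∫ y, (∑ i : Fin N, (pinnedChain ω₂ lam β γ).bondCurrent N
          i y) ∂((pinnedChain ω₂ lam β γ).transitionKernel N T T (Real.toNNReal t) z))) ^ 2)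
          ((pinnedChain ω₂ lam β γ).gibbsMeasure N T) ∧
      ∫ z, (∫ t in Ioc 0 τ, (∫ y, (∑ i : Fin N, (pinnedChain ω₂ lam β γ).bondCurrent N i y)
            ∂((pinnedChain ω₂ lam β γ).transitionKernel N T T (Real.toNNReal t) z))) ^ 2
            ∂((pinnedChain ω₂ lam β γ).gibbsMeasure N T) ≤ τ ^ 2 * ∫ z, (∑ i : Fin N, (pinnedChain
            ω₂ lam β γ).bondCurrent N i z) ^ 2 ∂((pinnedChain ω₂ lam β γ).gibbsMeasure N T) := by
  haveI : IsProbabilityMeasure ((pinnedChain ω₂ lam β γ).gibbsMeasure N T) :=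
        pinnedChain_isProbabilityMeasure_gibbsMeasure hω hl hβ.le γ N hT
  haveI : IsFiniteMeasure (Measure.restrict (volume : Measure ℝ) (Set.Ioc (0 : ℝ) τ)) :=
        isFiniteMeasure_restrict.2 measure_Ioc_lt_top.ne
  have hνu : ((Measure.restrict (volume : Measure ℝ) (Set.Ioc (0 : ℝ) τ))).real univ = τ := by
    rw [Measure.real, Measure.restrict_apply MeasurableSet.univ, univ_inter, Real.volume_Ioc,
      sub_zero, ENNReal.toReal_ofReal hτ]
  have hPJm : StronglyMeasurable fun p : PhaseSpace N × ℝ => (∫ y, (∑ i : Fin N, (pinnedChain ω₂ lam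
        β γ).bondCurrent N i y) ∂((pinnedChain ω₂ lam β γ).transitionKernel N T T (Real.toNNReal
        p.2) p.1)) :=
    pinnedChain_stronglyMeasurable_act_sum_bondCurrent hω hl hβ hγ
  have hG2 := pinnedChain_integrable_sq_act_prod hω hl hβ hγ hN hT τ
  -- `P_tJ` itself on the product (domination by `(1 + (P_tJ)²)/2`)
  have hG1 : Integrable (fun p : PhaseSpace N × ℝ => (∫ y, (∑ i : Fin N, (pinnedChain ω₂ lam β
        γ).bondCurrent N i y) ∂((pinnedChain ω₂ lam β γ).transitionKernel N T T (Real.toNNReal p.2)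
        p.1))) ((((pinnedChain ω₂ lam β γ).gibbsMeasure N T)).prod (Measure.restrict (volume :
        Measure ℝ) (Set.Ioc (0 : ℝ) τ))) := by
    have hone : Integrable (fun _ : PhaseSpace N × ℝ => (1 : ℝ)) ((((pinnedChain ω₂ lam β
          γ).gibbsMeasure N T)).prod (Measure.restrict (volume : Measure ℝ) (Set.Ioc (0 : ℝ) τ))) :=
      integrable_const _
    have hdom : Integrable (fun p : PhaseSpace N × ℝ => ((∫ y, (∑ i : Fin N, (pinnedChain ω₂ lam β
          γ).bondCurrent N i y) ∂((pinnedChain ω₂ lam β γ).transitionKernel N T T (Real.toNNReal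
          p.2) p.1)) ^ 2 + 1) / 2)
        ((((pinnedChain ω₂ lam β γ).gibbsMeasure N T)).prod (Measure.restrict (volume : Measure ℝ)
              (Set.Ioc (0 : ℝ) τ))) := (hG2.add hone).div_const 2
    refine hdom.mono' hPJm.aestronglyMeasurable (Eventually.of_forall fun p => ?_)
    rw [Real.norm_eq_abs]
    nlinarith [sq_nonneg (|(∫ y, (∑ i : Fin N, (pinnedChain ω₂ lam β γ).bondCurrent N i y)
          ∂((pinnedChain ω₂ lam β γ).transitionKernel N T T (Real.toNNReal p.2) p.1))| - 1), sq_abs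
          ((∫ y, (∑ i : Fin N, (pinnedChain ω₂ lam β γ).bondCurrent N i y) ∂((pinnedChain ω₂ lam β
          γ).transitionKernel N T T (Real.toNNReal p.2) p.1)))]
  -- slices: for a.e. `z`, `t ↦ P_tJ(z)` and its square are integrable on the window
  have hs1 : ∀ᵐ z ∂((pinnedChain ω₂ lam β γ).gibbsMeasure N T), Integrable (fun t => (∫ y, (∑ i :
        Fin N, (pinnedChain ω₂ lam β γ).bondCurrent N i y) ∂((pinnedChain ω₂ lam β
        γ).transitionKernel N T T (Real.toNNReal t) z))) (Measure.restrict (volume : Measure ℝ)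
        (Set.Ioc (0 : ℝ) τ)) :=
    ((integrable_prod_iff hPJm.aestronglyMeasurable).1 hG1).1
  have hs2 : ∀ᵐ z ∂((pinnedChain ω₂ lam β γ).gibbsMeasure N T), Integrable (fun t => (∫ y, (∑ i :
        Fin N, (pinnedChain ω₂ lam β γ).bondCurrent N i y) ∂((pinnedChain ω₂ lam β
        γ).transitionKernel N T T (Real.toNNReal t) z)) ^ 2) (Measure.restrict (volume : Measure ℝ)
        (Set.Ioc (0 : ℝ) τ)) :=
    ((integrable_prod_iff (hPJm.pow 2).aestronglyMeasurable).1 hG2).1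
  -- pointwise Jensen, a.e. in `z`
  have hJen : ∀ᵐ z ∂((pinnedChain ω₂ lam β γ).gibbsMeasure N T), (∫ t in Ioc 0 τ, (∫ y, (∑ i : Fin
        N, (pinnedChain ω₂ lam β γ).bondCurrent N i y) ∂((pinnedChain ω₂ lam β γ).transitionKernel N
        T T (Real.toNNReal t) z))) ^ 2 ≤ τ * ∫ t in Ioc 0 τ, (∫ y, (∑ i : Fin N, (pinnedChain ω₂ lam
        β γ).bondCurrent N i y) ∂((pinnedChain ω₂ lam β γ).transitionKernel N T T (Real.toNNReal t)
        z)) ^ 2 := by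
    filter_upwards [hs1, hs2] with z h1 h2
    exact sq_setIntegral_Ioc_le hτ h1 h2
  -- the right-hand side is integrable in `z`, with integral `≤ τ ∫ J²`
  have hI2 : Integrable (fun z => ∫ t in Ioc 0 τ, (∫ y, (∑ i : Fin N, (pinnedChain ω₂ lam β
        γ).bondCurrent N i y) ∂((pinnedChain ω₂ lam β γ).transitionKernel N T T (Real.toNNReal t)
        z)) ^ 2) ((pinnedChain ω₂ lam β γ).gibbsMeasure N T) := hG2.integral_prod_left
  have hval : ∫ z, (∫ t in Ioc 0 τ, (∫ y, (∑ i : Fin N, (pinnedChain ω₂ lam β γ).bondCurrent N i y)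
        ∂((pinnedChain ω₂ lam β γ).transitionKernel N T T (Real.toNNReal t) z)) ^ 2) ∂((pinnedChain
        ω₂ lam β γ).gibbsMeasure N T) ≤ τ * ∫ z, (∑ i : Fin N, (pinnedChain ω₂ lam β γ).bondCurrent
        N i z) ^ 2 ∂((pinnedChain ω₂ lam β γ).gibbsMeasure N T) := by
    rw [integral_integral_swap (f := fun (z : PhaseSpace N) (t : ℝ) => (∫ y, (∑ i : Fin N,
          (pinnedChain ω₂ lam β γ).bondCurrent N i y) ∂((pinnedChain ω₂ lam β γ).transitionKernel N
          T T (Real.toNNReal t) z)) ^ 2) hG2]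
    have hb : ∀ t : ℝ, ∫ z, (∫ y, (∑ i : Fin N, (pinnedChain ω₂ lam β γ).bondCurrent N i y)
          ∂((pinnedChain ω₂ lam β γ).transitionKernel N T T (Real.toNNReal t) z)) ^ 2 ∂((pinnedChain
          ω₂ lam β γ).gibbsMeasure N T) ≤ ∫ z, (∑ i : Fin N, (pinnedChain ω₂ lam β γ).bondCurrent N
          i z) ^ 2 ∂((pinnedChain ω₂ lam β γ).gibbsMeasure N T) := fun t =>
      (pinnedChain_sq_act_sum_bondCurrent hω hl hβ hγ hN hT t).2.2
    calc ∫ t in Ioc 0 τ, (∫ z, (∫ y, (∑ i : Fin N, (pinnedChain ω₂ lam β γ).bondCurrent N i y)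
          ∂((pinnedChain ω₂ lam β γ).transitionKernel N T T (Real.toNNReal t) z)) ^ 2 ∂((pinnedChain
          ω₂ lam β γ).gibbsMeasure N T)) ≤ ∫ _t in Ioc 0 τ, (∫ z, (∑ i : Fin N, (pinnedChain ω₂ lam
          β γ).bondCurrent N i z) ^ 2 ∂((pinnedChain ω₂ lam β γ).gibbsMeasure N T)) :=
          integral_mono_of_nonneg
            (Eventually.of_forall fun t => integral_nonneg fun z => sq_nonneg _)
            (integrable_const _) (Eventually.of_forall hb)
      _ = τ * ∫ z, (∑ i : Fin N, (pinnedChain ω₂ lam β γ).bondCurrent N i z) ^ 2 ∂((pinnedChain ω₂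
            lam β γ).gibbsMeasure N T) := by rw [integral_const, hνu, smul_eq_mul]
  have hum : AEStronglyMeasurable (fun z => (∫ t in Ioc 0 τ, (∫ y, (∑ i : Fin N, (pinnedChain ω₂ lam
        β γ).bondCurrent N i y) ∂((pinnedChain ω₂ lam β γ).transitionKernel N T T (Real.toNNReal t)
        z))) ^ 2) ((pinnedChain ω₂ lam β γ).gibbsMeasure N T) :=
    (hPJm.integral_prod_right'.pow 2).aestronglyMeasurable
  have hInt : Integrable (fun z => (∫ t in Ioc 0 τ, (∫ y, (∑ i : Fin N, (pinnedChain ω₂ lam β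
        γ).bondCurrent N i y) ∂((pinnedChain ω₂ lam β γ).transitionKernel N T T (Real.toNNReal t)
        z))) ^ 2) ((pinnedChain ω₂ lam β γ).gibbsMeasure N T) := by
    refine (hI2.const_mul τ).mono' hum ?_
    filter_upwards [hJen] with z hz
    rw [Real.norm_eq_abs, abs_of_nonneg (sq_nonneg _)]
    exact hz
  refine ⟨hInt, ?_⟩
  calc ∫ z, (∫ t in Ioc 0 τ, (∫ y, (∑ i : Fin N, (pinnedChain ω₂ lam β γ).bondCurrent N i y)
        ∂((pinnedChain ω₂ lam β γ).transitionKernel N T T (Real.toNNReal t) z))) ^ 2 ∂((pinnedChain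
        ω₂ lam β γ).gibbsMeasure N T) ≤ ∫ z, τ * (∫ t in Ioc 0 τ, (∫ y, (∑ i : Fin N, (pinnedChain
        ω₂ lam β γ).bondCurrent N i y) ∂((pinnedChain ω₂ lam β γ).transitionKernel N T T
        (Real.toNNReal t) z)) ^ 2) ∂((pinnedChain ω₂ lam β γ).gibbsMeasure N T) :=
        integral_mono_ae hInt (hI2.const_mul τ) hJen
    _ = τ * ∫ z, (∫ t in Ioc 0 τ, (∫ y, (∑ i : Fin N, (pinnedChain ω₂ lam β γ).bondCurrent N i y)
          ∂((pinnedChain ω₂ lam β γ).transitionKernel N T T (Real.toNNReal t) z)) ^ 2)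
          ∂((pinnedChain ω₂ lam β γ).gibbsMeasure N T) := integral_const_mul _ _
    _ ≤ τ * (τ * ∫ z, (∑ i : Fin N, (pinnedChain ω₂ lam β γ).bondCurrent N i z) ^ 2 ∂((pinnedChain
          ω₂ lam β γ).gibbsMeasure N T)) := mul_le_mul_of_nonneg_left hval hτ
    _ = τ ^ 2 * ∫ z, (∑ i : Fin N, (pinnedChain ω₂ lam β γ).bondCurrent N i z) ^ 2 ∂((pinnedChain ω₂
          lam β γ).gibbsMeasure N T) := by ring

end WindowSq

end Summit.AtomisticToContinuum.FouriersLaw.Theorems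

end
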